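import Literature.NumberTheory.EllipticCurves.DeuringSplitOrdinaryModelsProofs
import Literature.NumberTheory.EllipticCurves.IsogenyQuadraticTwistProofs
import Literature.NumberTheory.EllipticCurves.IsogenyXRationalFunctionProofs
import Literature.NumberTheory.EllipticCurves.ComplexMultiplicationHasCMProofs
import Summits.BirchSwinnertonDyer.Rank1Residual.X12.CMSevenAwayFromSeven
import Summits.BirchSwinnertonDyer.Rank1Residual.X12.CMTwoTorsion
import HarnessLib

set_option autoImplicit false

/-!
# `𝒞₇` genus road (crux `EllipticUnitValueSevenOfGZK`, K7r), row K2C-5 block (λ3): the CM isogeny `φ = √−7` of `W_K`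
# with `φ ∘ φ = [−7]` — the fields `φ` / `φ_sq` of `GenusSeven.PinnedKatoGenusFrame` are INHABITED (a THEOREM)

Cell `bsd-cm`, seat `bsd-cm-prr-ty1` g33 (literature-prover), SUMMON `wake/SUMMON-bsd-cm-prr-ty1-20260830T2227Z.md`
(3af2de90fa5f4927; planner D985), CHECK (ISO) on the cell STATUS.  For every elliptic curve `W/ℚ` whose CM field is `ℚ(√−7)`
(`cmFieldDiscrOfJ W.j = −7`, i.e. `j(W) ∈ {−3375, 16581375}`; in particular every `W ∈ 𝒞₇`) and every quadratic number
field `Kcm` with `s ∈ Kcm`, `s² = −7`, there is an ISOGENY `φ : W_{Kcm} → W_{Kcm}` DEFINED OVER `Kcm` (a term of the tree's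
`WeierstrassCurve.Isogeny (W.baseChange Kcm) (W.baseChange Kcm)`: algebraic off a finite set, `Γ_{Kcm}`-equivariant, finite
kernel) with `φ (φ P) = (−7) • P` on `W(K̄)` and `#ker φ = 7` — EXACTLY the two fields `φ`, `φ_sq` of
`PinnedKatoGenusFrame` (`RamifiedSevenGenusKatoPinnedFrame.lean` l.181–182), in the hypothesis currency `(hj, Kcm, h2, s, hs)`
of the Grössencharacter column (`RamifiedSevenGenusMemberGrossencharacter.lean`).

## The argument (Silverman, *Advanced Topics* II §2: `[√d] = τ ∘ φ`; here by certificate, for both `j`)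

* §1 ENGINE on the certified model over `Kcm`: the tree's kernel-checked `7`-isogeny certificates `cert7`
  (`E = [0,0,0,−2835,−71442]`, `j = −3375`) and `cert28` (`E = [0,0,0,−48195,−4072194]`, `j = 16581375`, the order `ℤ[√−7]`)
  are cyclic `7`-isogenies `E → E^{(−7)}` over `ℚ` (`CMIsogenyCertificates`; `IsogenyFormula.IsTwistBy (−7)`); the tree's
  `IsogenyFormula.sqrtEndo` turns such a formula, over ANY field `F ∋ r` of characteristic `0` with `r² = −7`, into an ISOGENY
  `[√−7] : E_F → E_F` over `F`, and `IsogenyFormula.sqrtEndo_comp_self` gives `[√−7]² = [−7]` once a ring automorphism of `F̄`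
  negating `r` is supplied (the trace term of *AEC* Cor. III.6.3 then vanishes).  Over `F = Kcm` that automorphism is the lift
  (`IsAlgClosure.equivOfEquiv`) of the non-trivial element of `Gal(Kcm/ℚ)`, which moves `s ∉ ℚ` to `−s`
  (`exists_ringEquiv_apply_eq_neg`; `Algebra.IsQuadraticExtension`, `IsGalois.mem_bot_iff_fixed`).
* §2 TRANSPORT KEEPING THE ISOGENY STRUCTURE: for `V/K` elliptic with `j(V) = j(E) ≠ 0, 1728`, `C • V = E^{(D)}` over `K`
  (`exists_variableChange_eq_quadraticTwist_of_j_eq`, *AEC* X.5.4); the twisted isogeny `ψ^{(D)} = ι⁻¹ ψ ι` is an isogeny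
  of `E^{(D)}` over `K` (tree `Isogeny.quadraticTwist`, Cremona §3.9), and its conjugate `e⁻¹ ∘ ψ^{(D)} ∘ e` by the
  `K`-isomorphism `e = pointEquivBaseChange V C K̄ : V(K̄) ≃ (C • V)(K̄)` is again an ISOGENY of `V` over `K` (algebraic:
  `isAlgebraicOn_pointEquivBaseChange`, `isAlgebraicOn_pointEquiv_trans_congrEquiv_symm`, `IsAlgebraicOn.comp`; equivariant:
  `pointEquivBaseChange_map_algEquiv` / `_symm_map`; finite kernel), with the same square and the same degree.  (The tree's
  `Theorems/PrintCFramSqrtEndomorphismOnLeaf.lean` has this transport with an ADDITIVE output only; it is not imported — its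
  closure contains the route's `Theses` — and nothing here restates its letters.)
* §3 `j = −3375` / `j = 16581375` (`X12.j_eq_of_cmFieldDiscrOfJ_eq_neg_seven`), and the `𝒞₇` corollary.

THEOREMS ONLY (0 `def`, 0 named fact, 0 instance, 0 notation, 0 sorry; kit 0: `decide` only on certificate numerics).
HONEST LABEL: this inhabits two fields of a hypothesis structure; it does NOT construct a `PinnedKatoGenusFrame`, closes no
stub; stmt-BirchSwinnertonDyer-19945 is OPEN; `X12.CMRamifiedSeven` is NOT proved; no summit statement is proved by this seat;
BSD is claimed for no curve.

References: [SilvermanAdvancedTopics1994] II §2 Prop. II.2.3.1, Thm. II.2.2 (b), Example II.2.3.2, App. A §3;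
[SilvermanAEC2009] Thm. III.4.8, Remark III.4.13.3, Cor. III.6.3, X.5 Prop. 5.4; [CremonaAlgorithms1997] §3.9 (p. 87), Table 1
(class `49a`); [Kato2004Asterisque] 15.14 (p. 264: `O_λ` acting on the `K`-side cohomology through the CM lattice).
-/

noncomputable section

open scoped Classical

open Polynomial WeierstrassCurve Field
  Literature.NumberTheory.EllipticCurves
  Literature.NumberTheory.EllipticCurves.PolyCert
  Literature.NumberTheory.EllipticCurves.CMIsogenyCert
  Literature.NumberTheory.EllipticCurves.DeuringModels
  Literature.NumberTheory.EllipticCurves.Rank1Residual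

namespace Summit.BirchSwinnertonDyer.Rank1Residual.Additive.GenusSeven.CMIsogeny

/-! ## §0 The quadratic field: a ring automorphism negating `s = √−7` -/

/-- **A quadratic number field containing `s` with `s² = −7` has a ring automorphism `τ` with `τ s = −s`**: `Kcm/ℚ` is Galois
of degree `2` (`Algebra.IsQuadraticExtension`); if every `ℚ`-automorphism fixed `s` then `s ∈ ℚ` (`IsGalois.mem_bot_iff_fixed`)
and `s² = −7 < 0` would be a rational square.  Any automorphism sends `s` to `±s`, so one sends it to `−s`.
[cite: Lang1990, Ch. 13 §4 (cyclic extensions)] -/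
theorem exists_ringEquiv_apply_eq_neg (Kcm : Type) [Field Kcm] [NumberField Kcm] (h2 : Module.finrank ℚ Kcm = 2)
    (s : Kcm) (hs : s ^ 2 = -7) : ∃ τ : Kcm ≃+* Kcm, τ s = -s := by
  haveI : Algebra.IsQuadraticExtension ℚ Kcm := ⟨h2⟩
  have hτ : ∃ τ : Kcm ≃ₐ[ℚ] Kcm, τ s = -s := by
    by_contra h
    push Not at h
    have hfix : ∀ τ : Kcm ≃ₐ[ℚ] Kcm, τ s = s := fun τ ↦ by
      have hsq : (τ s) ^ 2 = s ^ 2 := by rw [← map_pow, hs, map_neg, map_ofNat]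
      rcases sq_eq_sq_iff_eq_or_eq_neg.mp hsq with h3 | h3
      · exact h3
      · exact absurd h3 (h τ)
    have hmem : s ∈ (⊥ : IntermediateField ℚ Kcm) := (IsGalois.mem_bot_iff_fixed s).mpr hfix
    rw [IntermediateField.mem_bot] at hmem
    obtain ⟨q, hq⟩ := hmem
    have hq2 : algebraMap ℚ Kcm (q ^ 2) = algebraMap ℚ Kcm (-7) := by
      rw [map_pow, hq, hs, map_neg, map_ofNat]
    have hq3 : q ^ 2 = -7 := (algebraMap ℚ Kcm).injective hq2
    nlinarith [sq_nonneg q]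
  obtain ⟨τ, hτ⟩ := hτ
  exact ⟨τ.toRingEquiv, hτ⟩

/-! ## §1 The engine: `[√−7]` on a certified model over `Kcm`, as an ISOGENY, with `[√−7]² = [−7]` and `#ker = deg U` -/

section Engine

variable {c : IsogenyCert}

/-- **`[√−7] ∈ End_{Kcm}(E_c ⊗ Kcm)` as an isogeny over `Kcm`, with `[√−7] ∘ [√−7] = [−7]` and `#ker [√−7] = deg U`**, for a
checked CM twist certificate `c` of a cyclic isogeny `E_c → E_c^{(−7)}` over `ℚ` (`DeuringCert.IsCMTwistCert c (−7)`), a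
Bézout certificate for `(U, h)`, and a quadratic number field `Kcm ∋ s`, `s² = −7`: the tree's `IsogenyFormula.sqrtEndo` of the
certified formula read over `Kcm` with `r = s` (Silverman, *Advanced Topics* II §2 Prop. 2.3.1: `[√d] = τ ∘ φ`), squared by
`IsogenyFormula.sqrtEndo_comp_self` against the conjugation of `K̄cm` lifting the automorphism of §0 (`IsAlgClosure.equivOfEquiv`),
with `deg U = 7` from the certificate; `#ker = deg` in characteristic `0` (`Isogeny.degree_eq_deg`, `IsogenyFormula.deg_sqrtEndo`).
[cite: SilvermanAdvancedTopics1994, II §2, Prop. II.2.3.1 and Example II.2.3.2] [cite: SilvermanAEC2009, Cor. III.6.3 and Thm. III.4.10 (a),(c)] -/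
theorem exists_sqrtIsogeny_of_cert_neg_seven (hc : c.check = true) (H : DeuringCert.IsCMTwistCert c (-7))
    (cop : CoprimeCert) {k' : ℕ} (hcop : c.checkCoprime cop k' = true) (hℓ : cop.ℓ.Prime)
    (Kcm : Type) [Field Kcm] [NumberField Kcm] (h2 : Module.finrank ℚ Kcm = 2) (s : Kcm) (hs : s ^ 2 = -7)
    [hE : ((DeuringCert.curve c).map (Int.castRingHom Kcm)).IsElliptic] :
    ∃ ψ : Isogeny ((DeuringCert.curve c).map (Int.castRingHom Kcm)) ((DeuringCert.curve c).map (Int.castRingHom Kcm)),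
      (∀ P, ψ (ψ P) = (-7 : ℤ) • P) ∧ ψ.degree = c.U.length - 1 := by
  obtain ⟨τ, hτ⟩ := exists_ringEquiv_apply_eq_neg Kcm h2 s hs
  have hθ : s ^ 2 = ((-7 : ℤ) : Kcm) := by rw [hs]; push_cast; ring
  have hs0 : s ≠ 0 := by
    rintro rfl
    norm_num at hs
  set E := (DeuringCert.curve c).map (Int.castRingHom Kcm) with hEdef
  set E' := (DeuringCert.curve' c).map (Int.castRingHom Kcm) with hE'def
  let φ : IsogenyFormula E E' := c.toFormula hc E E' rfl rfl
  have HK : φ.IsTwistBy (((-7 : ℤ) : Kcm)) :=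
    { a₁ := by change (Int.castRingHom Kcm) c.a₁ = 0; rw [H.a₁, map_zero]
      a₂ := by change (Int.castRingHom Kcm) c.a₂ = 0; rw [H.a₂, map_zero]
      a₃ := by change (Int.castRingHom Kcm) c.a₃ = 0; rw [H.a₃, map_zero]
      a₁' := by change (Int.castRingHom Kcm) c.a₁' = 0; rw [H.a₁', map_zero]
      a₂' := by change (Int.castRingHom Kcm) c.a₂' = 0; rw [H.a₂', map_zero]
      a₃' := by change (Int.castRingHom Kcm) c.a₃' = 0; rw [H.a₃', map_zero]
      a₄' := by
        change (Int.castRingHom Kcm) c.a₄' = _ * (Int.castRingHom Kcm) c.a₄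
        rw [H.a₄', map_mul, map_pow, eq_intCast]
      a₆' := by
        change (Int.castRingHom Kcm) c.a₆' = _ * (Int.castRingHom Kcm) c.a₆
        rw [H.a₆', map_mul, map_pow, eq_intCast]
      T := by change (ofList c.T : Kcm[X]) = 0; rw [H.T]; rfl }
  -- the conjugation of `K̄cm` lifting `τ`
  let σ : AlgebraicClosure Kcm ≃+* AlgebraicClosure Kcm :=
    IsAlgClosure.equivOfEquiv (AlgebraicClosure Kcm) (AlgebraicClosure Kcm) τ
  have hσθ : σ (algebraMap Kcm _ s) = -algebraMap Kcm _ s := by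
    change IsAlgClosure.equivOfEquiv (AlgebraicClosure Kcm) (AlgebraicClosure Kcm) τ (algebraMap Kcm _ s) = _
    rw [IsAlgClosure.equivOfEquiv_algebraMap, hτ, map_neg]
  have hσW : (E.baseChange (AlgebraicClosure Kcm)).map σ.toRingHom = E.baseChange (AlgebraicClosure Kcm) := by
    simp only [hEdef, WeierstrassCurve.baseChange, WeierstrassCurve.map_map]
    congr 1
    exact Subsingleton.elim _ _
  have hU : φ.U = (ofList c.U : Kcm[X]) := rfl
  have hh : φ.h = (ofList c.h : Kcm[X]) := rfl
  have hS : φ.S = (ofList c.S : Kcm[X]) := rfl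
  have hσU : (φ.U.map (algebraMap Kcm (AlgebraicClosure Kcm))).map σ.toRingHom =
      φ.U.map (algebraMap Kcm (AlgebraicClosure Kcm)) := by
    rw [hU, IsogenyCert.map_ofList, IsogenyCert.map_ofList]
  have hσh : (φ.h.map (algebraMap Kcm (AlgebraicClosure Kcm))).map σ.toRingHom =
      φ.h.map (algebraMap Kcm (AlgebraicClosure Kcm)) := by
    rw [hh, IsogenyCert.map_ofList, IsogenyCert.map_ofList]
  have hσS : (φ.S.map (algebraMap Kcm (AlgebraicClosure Kcm))).map σ.toRingHom =
      φ.S.map (algebraMap Kcm (AlgebraicClosure Kcm)) := by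
    rw [hS, IsogenyCert.map_ofList, IsogenyCert.map_ofList]
  have hcopK : IsCoprime (φ.U.map (algebraMap Kcm (AlgebraicClosure Kcm)))
      (φ.h.map (algebraMap Kcm (AlgebraicClosure Kcm))) := by
    rw [hU, hh, IsogenyCert.map_ofList, IsogenyCert.map_ofList]
    exact IsogenyCert.isCoprime_of_checkCoprime hcop hℓ _
  have hdegU' : φ.U.natDegree = c.U.length - 1 := by
    rw [hU]; exact IsogenyCert.natDegree_ofList_eq c.U (by rw [H.U_top]; exact one_ne_zero)
  have hdegU : (φ.U.natDegree : ℤ) = 7 := by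
    have h := H.deg
    rw [hdegU']; omega
  haveI : E'.IsElliptic := by
    -- `E' = E^{(−7)}` has discriminant `(−7)⁶ Δ(E)`; read from the certificate's twist relation
    rw [WeierstrassCurve.isElliptic_iff, isUnit_iff_ne_zero]
    have hΔE : E.Δ ≠ 0 := by rw [← WeierstrassCurve.coe_Δ']; exact E.Δ'.ne_zero
    have hd0 : ((-7 : ℤ) : Kcm) ≠ 0 := by norm_num
    have e : E'.Δ = ((-7 : ℤ) : Kcm) ^ 6 * E.Δ := by
      have h1 : E'.a₁ = 0 := HK.a₁'
      have h2' : E'.a₂ = 0 := HK.a₂'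
      have h3 : E'.a₃ = 0 := HK.a₃'
      have h4 : E'.a₄ = ((-7 : ℤ) : Kcm) ^ 2 * E.a₄ := HK.a₄'
      have h6 : E'.a₆ = ((-7 : ℤ) : Kcm) ^ 3 * E.a₆ := HK.a₆'
      have g1 : E.a₁ = 0 := HK.a₁
      have g2 : E.a₂ = 0 := HK.a₂
      have g3 : E.a₃ = 0 := HK.a₃
      simp only [WeierstrassCurve.Δ, WeierstrassCurve.b₂, WeierstrassCurve.b₄, WeierstrassCurve.b₆,
        WeierstrassCurve.b₈, h1, h2', h3, h4, h6, g1, g2, g3]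
      ring
    rw [e]
    exact mul_ne_zero (pow_ne_zero 6 hd0) hΔE
  refine ⟨φ.sqrtEndo HK s hθ hs0, fun P ↦ ?_, ?_⟩
  · rw [φ.sqrtEndo_comp_self HK s hθ hs0 σ hσθ hσW hσU hσh hσS hcopK P, hdegU, neg_smul]
  · rw [Isogeny.degree_eq_deg, φ.deg_sqrtEndo HK s hθ hs0 hcopK, hdegU']

end Engine

/-! ## §2 Transport to every curve with the same `j`-invariant, KEEPING the isogeny structure -/

section Transport

variable {K : Type} [Field K]

/-- **Conjugating an isogeny by a `K`-isomorphism of models is an isogeny.** If `C • V = X` over `K` and `ψ : X → X` is an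
isogeny over `K`, then `e⁻¹ ∘ ψ ∘ e`, `e = pointEquivBaseChange V C K̄ : V(K̄) ≃ X(K̄)` the substitution isomorphism of `C`, is
an isogeny `V → V` over `K` (algebraic as a composite of algebraic additive maps; `Γ_K`-equivariant because `e` is; finite
kernel), acting by `P ↦ e⁻¹ (ψ (e P))` — so `ψ ∘ ψ = [d]` transports to it — with the same `#ker`.  Silverman, *AEC*
III.3.1 (b) (a change of variables is an isomorphism over `K`), III.4 (isogenies compose).
[cite: SilvermanAEC2009, III.3.1 (b) and III.4 (Def.), Thm. III.4.8] -/
theorem exists_isogeny_conj_of_smul_eq {V X : WeierstrassCurve K} {C : VariableChange K} (hC : C • V = X)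
    {d : ℤ} (ψ : Isogeny X X) (hψ : ∀ Q, ψ (ψ Q) = d • Q) :
    ∃ f : Isogeny V V, (∀ P, f (f P) = d • P) ∧ f.degree = ψ.degree := by
  subst hC
  -- the substitution isomorphism of `C`, read on the type synonyms `geomPoints`
  let e : V.geomPoints ≃+ (C • V).geomPoints := VariableChange.pointEquivBaseChange V C (AlgebraicClosure K)
  have halg_e : IsAlgebraicOn V (C • V) (fun Q : V.geomPoints => e Q) :=
    VariableChange.isAlgebraicOn_pointEquivBaseChange V C
  have halg_esymm : IsAlgebraicOn (C • V) V (fun Q : (C • V).geomPoints => e.symm Q) :=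
    isAlgebraicOn_pointEquiv_trans_congrEquiv_symm (C.map (algebraMap K (AlgebraicClosure K)))
      (VariableChange.baseChange_smul_eq V C (AlgebraicClosure K)).symm
  have halg : IsAlgebraicOn V V
      (fun P ↦ (e.symm.toAddMonoidHom.comp (ψ.toAddMonoidHom.comp e.toAddMonoidHom)) P) := by
    have h1 := IsAlgebraicOn.comp (W := V) (W' := C • V) (W'' := C • V) (f := ψ.toAddMonoidHom)
      (g := e.toAddMonoidHom) ψ.isAlgebraic halg_e
    exact IsAlgebraicOn.comp (W := V) (W' := C • V) (W'' := V) (f := e.symm.toAddMonoidHom)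
      (g := ψ.toAddMonoidHom.comp e.toAddMonoidHom) halg_esymm h1
  refine ⟨{ toAddMonoidHom := e.symm.toAddMonoidHom.comp (ψ.toAddMonoidHom.comp e.toAddMonoidHom)
            isAlgebraic := halg
            equivariant := fun σ P ↦ ?_
            finite_ker := IsAlgebraicOn.finite_ker halg }, fun P ↦ ?_, ?_⟩
  · change e.symm (ψ (e (σ • P))) = σ • e.symm (ψ (e P))
    have h1 : e (σ • P) = σ • e P := VariableChange.pointEquivBaseChange_map_algEquiv V C σ P
    have h2 : e.symm (σ • ψ (e P)) = σ • e.symm (ψ (e P)) :=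
      (VariableChange.pointEquivBaseChange_symm_map V C
        ((show AlgebraicClosure K ≃ₐ[K] AlgebraicClosure K from σ) : AlgebraicClosure K →ₐ[K] AlgebraicClosure K)
        (ψ (e P))).symm
    rw [h1, ψ.map_smul, h2]
  · change e.symm (ψ (e (e.symm (ψ (e P))))) = d • P
    rw [e.apply_symm_apply, hψ, map_zsmul, e.symm_apply_apply]
  · unfold Isogeny.degree
    refine Nat.card_congr (Equiv.subtypeEquiv e.toEquiv fun P ↦ ?_)
    rw [AddMonoidHom.mem_ker, AddMonoidHom.mem_ker]
    change e.symm (ψ (e P)) = 0 ↔ ψ (e P) = 0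
    exact e.symm.map_eq_zero_iff

/-- **`[√d]` as an ISOGENY on EVERY elliptic `V/K` with `j(V) = j(E)`** (`j ≠ 0, 1728`): if `E/K` (`a₁ = a₃ = 0`) carries an
isogeny `ψ : E → E` over `K` with `ψ ∘ ψ = [d]`, then so does `V`: `C • V = E^{(D)}` for some `D ∈ K^×` (*AEC* X.5.4, tree
`exists_variableChange_eq_quadraticTwist_of_j_eq`), `ψ^{(D)} = ι⁻¹ψι` is an isogeny of `E^{(D)}` over `K` with the same square
(tree `Isogeny.quadraticTwist`, Cremona §3.9), and its conjugate by the `K`-isomorphism of `C` is the sought isogeny of `V`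
(`exists_isogeny_conj_of_smul_eq`), with the same `#ker`. [cite: SilvermanAEC2009, X.5 Prop. 5.4 and Cor. 5.4.1]
[cite: CremonaAlgorithms1997, §3.9 (p. 87)] -/
theorem exists_isogeny_sq_of_j_eq [CharZero K] {E : WeierstrassCurve K} [E.IsElliptic] [E.IsCharNeTwoNF]
    (h0 : E.j ≠ 0) (h1728 : E.j ≠ 1728) {d : ℤ} (ψ : Isogeny E E) (hψ : ∀ P, ψ (ψ P) = d • P)
    (V : WeierstrassCurve K) [V.IsElliptic] (hj : V.j = E.j) :
    ∃ f : Isogeny V V, (∀ P, f (f P) = d • P) ∧ f.degree = ψ.degree := by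
  haveI : NeZero (2 : K) := ⟨two_ne_zero⟩
  obtain ⟨D, hD, C, hC⟩ := exists_variableChange_eq_quadraticTwist_of_j_eq hj h0 h1728
  set ψD := ψ.quadraticTwist hD with hψD
  have hψDψD : ∀ Q, ψD (ψD Q) = d • Q := fun Q ↦ by
    rw [hψD, Isogeny.quadraticTwist_apply, Isogeny.quadraticTwist_apply, AddEquiv.apply_symm_apply,
      hψ, map_zsmul, AddEquiv.symm_apply_apply]
  obtain ⟨f, hf, hdeg⟩ := exists_isogeny_conj_of_smul_eq hC ψD hψDψD
  exact ⟨f, hf, by rw [hdeg, hψD, Isogeny.degree_quadraticTwist]⟩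

end Transport

/-! ## §3 The two `𝒞₇` `j`-invariants and the frame fields `φ` / `φ_sq` -/

section Member

/-- `j` of an integral model read over a field of characteristic `0`: `c₄³ = n Δ` over `ℤ` (with `Δ ≠ 0`) gives `j = n`;
and such a model is elliptic. [folklore] -/
theorem isElliptic_and_j_map_intCast (M : WeierstrassCurve ℤ) (K : Type) [Field K] [CharZero K] (n : ℤ)
    (hΔ : M.Δ ≠ 0) (h : M.c₄ ^ 3 = n * M.Δ) :
    ∃ _ : (M.map (Int.castRingHom K)).IsElliptic, (M.map (Int.castRingHom K)).j = n := by
  have hE : (M.map (Int.castRingHom K)).IsElliptic := by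
    rw [WeierstrassCurve.isElliptic_iff, WeierstrassCurve.map_Δ, isUnit_iff_ne_zero, eq_intCast, Int.cast_ne_zero]
    exact hΔ
  refine ⟨hE, ?_⟩
  have hΔK : (M.map (Int.castRingHom K)).Δ ≠ 0 := by
    rw [← WeierstrassCurve.coe_Δ']; exact (M.map (Int.castRingHom K)).Δ'.ne_zero
  rw [j_eq_c₄_pow_three_div_Δ, div_eq_iff hΔK, map_c₄, map_Δ, eq_intCast, eq_intCast, ← Int.cast_pow, h, Int.cast_mul]

/-- **`[√−7]` on `W_{Kcm}` for `j(W) = −3375`** (the maximal order; certificate `cert7`): an isogeny `φ` of `W.baseChange Kcm`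
over `Kcm` with `φ (φ P) = (−7) • P` and `#ker φ = 7`. [cite: SilvermanAdvancedTopics1994, II §2 Prop. II.2.3.1, Example II.2.3.2 and App. A §3 (row D = −7)] -/
theorem exists_isogeny_sq_eq_neg_seven_of_j_eq_neg3375 {W : WeierstrassCurve ℚ} [W.IsElliptic] (hjW : W.j = -3375)
    (Kcm : Type) [Field Kcm] [NumberField Kcm] (h2 : Module.finrank ℚ Kcm = 2) (s : Kcm) (hs : s ^ 2 = -7) :
    ∃ φ : Isogeny (W.baseChange Kcm) (W.baseChange Kcm),
      (∀ P : (W.baseChange Kcm).geomPoints, φ (φ P) = (-7 : ℤ) • P) ∧ φ.degree = 7 := by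
  obtain ⟨hE, hjE⟩ := isElliptic_and_j_map_intCast (DeuringCert.curve cert7) Kcm (-3375)
    (by rw [model7.1]; norm_num) model7.2
  haveI := hE
  haveI : ((DeuringCert.curve cert7).map (Int.castRingHom Kcm)).IsCharNeTwoNF :=
    ⟨by change (Int.castRingHom Kcm) cert7.a₁ = 0; rw [isCMTwistCert_cert7.a₁, map_zero],
     by change (Int.castRingHom Kcm) cert7.a₃ = 0; rw [isCMTwistCert_cert7.a₃, map_zero]⟩
  haveI : (W.baseChange Kcm).IsElliptic := inferInstanceAs (W.map (algebraMap ℚ Kcm)).IsElliptic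
  obtain ⟨ψ, hψ, hdeg⟩ := exists_sqrtIsogeny_of_cert_neg_seven (IsogenyCert.check_of_checkFast checkFast_cert7)
    isCMTwistCert_cert7 cert7Cop checkCoprime_cert7 (by rw [show cert7Cop.ℓ = 10007 from rfl]; exact prime_10007)
    Kcm h2 s hs
  have hjW' : (W.baseChange Kcm).j = ((DeuringCert.curve cert7).map (Int.castRingHom Kcm)).j := by
    rw [hjE]; simp only [baseChange, map_j, hjW, map_neg, map_ofNat, Int.cast_neg, Int.cast_ofNat]
  obtain ⟨φ, hφ, hdegφ⟩ := exists_isogeny_sq_of_j_eq (by rw [hjE]; norm_num) (by rw [hjE]; norm_num) ψ hψ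
    (W.baseChange Kcm) hjW'
  exact ⟨φ, hφ, by rw [hdegφ, hdeg]; decide⟩

/-- **`[√−7]` on `W_{Kcm}` for `j(W) = 16581375`** (the order `ℤ[√−7]`; certificate `cert28`, whose numeric side conditions
— short models, `E′ = E^{(−7)}`, monic `U, h`, `deg U = 7`, `Δ = 2¹²3¹²7³ ≠ 0`, `c₄³ = 16581375·Δ` — are decided in place): an
isogeny `φ` of `W.baseChange Kcm` over `Kcm` with `φ (φ P) = (−7) • P` and `#ker φ = 7`.
[cite: SilvermanAdvancedTopics1994, II §2 Prop. II.2.3.1 and App. A §3 (row D = −28)] [cite: CremonaAlgorithms1997, §3.8 and Table 1 (class 49a)] -/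
theorem exists_isogeny_sq_eq_neg_seven_of_j_eq_16581375 {W : WeierstrassCurve ℚ} [W.IsElliptic] (hjW : W.j = 16581375)
    (Kcm : Type) [Field Kcm] [NumberField Kcm] (h2 : Module.finrank ℚ Kcm = 2) (s : Kcm) (hs : s ^ 2 = -7) :
    ∃ φ : Isogeny (W.baseChange Kcm) (W.baseChange Kcm),
      (∀ P : (W.baseChange Kcm).geomPoints, φ (φ P) = (-7 : ℤ) • P) ∧ φ.degree = 7 := by
  have H28 : DeuringCert.IsCMTwistCert cert28 (-7) :=
    { a₁ := rfl, a₂ := rfl, a₃ := rfl, a₁' := rfl, a₂' := rfl, a₃' := rfl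
      a₄' := by decide, a₆' := by decide, T := rfl
      U_top := by decide, h_top := by decide, deg := by decide }
  have hmodel : (DeuringCert.curve cert28).Δ = 2 ^ 12 * 3 ^ 12 * 7 ^ 3 ∧
      (DeuringCert.curve cert28).c₄ ^ 3 = 16581375 * (DeuringCert.curve cert28).Δ := by
    constructor <;> decide
  obtain ⟨hE, hjE⟩ := isElliptic_and_j_map_intCast (DeuringCert.curve cert28) Kcm 16581375
    (by rw [hmodel.1]; norm_num) hmodel.2
  haveI := hE
  haveI : ((DeuringCert.curve cert28).map (Int.castRingHom Kcm)).IsCharNeTwoNF :=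
    ⟨by change (Int.castRingHom Kcm) cert28.a₁ = 0; rw [H28.a₁, map_zero],
     by change (Int.castRingHom Kcm) cert28.a₃ = 0; rw [H28.a₃, map_zero]⟩
  haveI : (W.baseChange Kcm).IsElliptic := inferInstanceAs (W.map (algebraMap ℚ Kcm)).IsElliptic
  obtain ⟨ψ, hψ, hdeg⟩ := exists_sqrtIsogeny_of_cert_neg_seven (IsogenyCert.check_of_checkFast checkFast_cert28)
    H28 cert28Cop checkCoprime_cert28 (by rw [show cert28Cop.ℓ = 10007 from rfl]; exact prime_10007) Kcm h2 s hs
  have hjW' : (W.baseChange Kcm).j = ((DeuringCert.curve cert28).map (Int.castRingHom Kcm)).j := by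
    rw [hjE]; simp only [baseChange, map_j, hjW, map_ofNat, Int.cast_ofNat]
  obtain ⟨φ, hφ, hdegφ⟩ := exists_isogeny_sq_of_j_eq (by rw [hjE]; norm_num) (by rw [hjE]; norm_num) ψ hψ
    (W.baseChange Kcm) hjW'
  exact ⟨φ, hφ, by rw [hdegφ, hdeg]; decide⟩

/-- **THE FIELDS `φ` / `φ_sq` OF `PinnedKatoGenusFrame`, INHABITED — with the degree.**  For `W/ℚ` elliptic with CM field
`ℚ(√−7)` (`cmFieldDiscrOfJ W.j = −7`) and any quadratic number field `Kcm ∋ s`, `s² = −7`: an isogeny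
`φ : W_{Kcm} → W_{Kcm}` over `Kcm` with `φ (φ P) = (−7) • P` on `W(K̄)` and `#ker φ = 7` (so `ker φ = W[𝔭]`, `𝔭 = (√−7)`).
The two `j`-invariants `−3375`, `16581375` (`X12.j_eq_of_cmFieldDiscrOfJ_eq_neg_seven`) separately.
[cite: SilvermanAdvancedTopics1994, II §2 Thm. II.2.2 (b), Prop. II.2.3.1 and App. A §3] [cite: Kato2004Asterisque, 15.14 (p. 264)] -/
theorem exists_cmIsogeny_sq_eq_neg_seven' {W : WeierstrassCurve ℚ} [W.IsElliptic] (hj : cmFieldDiscrOfJ W.j = -7)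
    (Kcm : Type) [Field Kcm] [NumberField Kcm] (h2 : Module.finrank ℚ Kcm = 2) (s : Kcm) (hs : s ^ 2 = -7) :
    ∃ φ : Isogeny (W.baseChange Kcm) (W.baseChange Kcm),
      (∀ P : (W.baseChange Kcm).geomPoints, φ (φ P) = (-7 : ℤ) • P) ∧ φ.degree = 7 := by
  rcases X12.j_eq_of_cmFieldDiscrOfJ_eq_neg_seven hj with h | h
  · exact exists_isogeny_sq_eq_neg_seven_of_j_eq_neg3375 h Kcm h2 s hs
  · exact exists_isogeny_sq_eq_neg_seven_of_j_eq_16581375 h Kcm h2 s hs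

/-- **THE FIELDS `φ` / `φ_sq` OF `PinnedKatoGenusFrame`, INHABITED** (`RamifiedSevenGenusKatoPinnedFrame.lean` l.181–182,
letter for letter): for `W/ℚ` elliptic with `cmFieldDiscrOfJ W.j = −7` and any quadratic number field `Kcm ∋ s`, `s² = −7`,
there is `φ : WeierstrassCurve.Isogeny (W.baseChange Kcm) (W.baseChange Kcm)` with
`∀ P : (W.baseChange Kcm).geomPoints, φ (φ P) = (-7 : ℤ) • P` — the CM endomorphism `√−7` of `W_K`, defined over `K`.
[cite: SilvermanAdvancedTopics1994, II §2 Thm. II.2.2 (b) and Prop. II.2.3.1] [cite: Kato2004Asterisque, 15.14 (p. 264)] -/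
theorem exists_cmIsogeny_sq_eq_neg_seven {W : WeierstrassCurve ℚ} [W.IsElliptic] (hj : cmFieldDiscrOfJ W.j = -7)
    (Kcm : Type) [Field Kcm] [NumberField Kcm] (h2 : Module.finrank ℚ Kcm = 2) (s : Kcm) (hs : s ^ 2 = -7) :
    ∃ φ : WeierstrassCurve.Isogeny (W.baseChange Kcm) (W.baseChange Kcm),
      ∀ P : (W.baseChange Kcm).geomPoints, φ (φ P) = (-7 : ℤ) • P :=
  (exists_cmIsogeny_sq_eq_neg_seven' hj Kcm h2 s hs).imp fun _ h ↦ h.1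

/-- **The (λ3) isogeny column on the class `𝒞₇`** (`X12.ClassCSeven W` carries `cmFieldDiscrOfJ W.j = −7`).
[cite: SilvermanAdvancedTopics1994, II §2 Thm. II.2.2 (b) and Prop. II.2.3.1] -/
theorem exists_cmIsogeny_sq_eq_neg_seven_of_classCSeven {W : WeierstrassCurve ℚ} [W.IsElliptic] [W.IsGloballyMinimal]
    (hC : X12.ClassCSeven W) (Kcm : Type) [Field Kcm] [NumberField Kcm] (h2 : Module.finrank ℚ Kcm = 2)
    (s : Kcm) (hs : s ^ 2 = -7) :
    ∃ φ : WeierstrassCurve.Isogeny (W.baseChange Kcm) (W.baseChange Kcm),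
      ∀ P : (W.baseChange Kcm).geomPoints, φ (φ P) = (-7 : ℤ) • P :=
  exists_cmIsogeny_sq_eq_neg_seven hC.2.1 Kcm h2 s hs

end Member

end Summit.BirchSwinnertonDyer.Rank1Residual.Additive.GenusSeven.CMIsogeny

end
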